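import Summits.AnomalousDissipation.AnomalousDissipation.Theorems.DenseLoudDesignerForces.Negative.FourierSlices

/-!
# Negative knowledge for the crux `DenseLoudDesignerForces` (stmt-AnomalousDissipation-1143), XII-b: the
# constant-flux law of loud periodic orbits (witness anatomy III)

Certified copy of the second half of §15 of the cdisprove work file (generation 3).  For the energy flux
`Π_N(t) = ∫⟪(u·∇)u, P_N u⟫` out of the Fourier ball `|k| ≤ N` (`P_N = Torus.fourierTruncate N`), every `τ`-periodic
classical solution of NS_ν forced by the designer force `f_c` with `S ⊆ B_N` satisfies the LOW-MODE ENERGY BALANCE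
`½E_N' = -Π_N - νG_N + ∫⟪f_c, u⟫` (`integral_inner_timeDeriv_fourierTruncate`) and the MEAN-FLUX IDENTITY
`τ⁻¹∫₀^τ Π_N = ⟨ν‖∇u‖²⟩ - ν τ⁻¹∫₀^τ G_N` (`mean_flux_eq`), hence
`⟨ν‖∇u‖²⟩ - 4π²N²ν⟨‖u‖²⟩ ≤ τ⁻¹∫₀^τ Π_N ≤ ⟨ν‖∇u‖²⟩` (`mean_flux_ge`, `mean_flux_le`) and, for a witness of a loud
point `c ∈ LOUD_j(S,E,ε)`, `ε - 4π²N²E/(j+1) ≤ τ⁻¹∫₀^τ Π_N` for EVERY `N ≥ deg S`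
(`mean_flux_ge_of_loud`, `exists_constantFlux_of_mem_loudSet`): the mean triadic energy flux of a loud orbit is
constant — equal to the dissipation up to `O(N²/j)` — across an inertial range that widens without bound along the
levels: the cascade of a loud witness must be complete.  Supports stmt-AnomalousDissipation-1143.
-/

noncomputable section

namespace Summit.AnomalousDissipation.AnomalousDissipation.Theorems.DenseLoudDesignerForces.Negative

open scoped BigOperators Topology ENNReal InnerProductSpace
open Filter Set MeasureTheory UnitAddTorus
open Literature.Analysis.FunctionSpaces Literature.Analysis.FluidPDE
open Summit.AnomalousDissipation.AnomalousDissipation.Theses.BaireTransfer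

/-! ## §15 Witness anatomy III: the CONSTANT-FLUX LAW — a loud orbit runs a complete cascade through every wavenumber

Fourier-truncate the witness at wavenumber `N` (`P_N`, `Torus.fourierTruncate`) and follow the LOW-MODE ENERGY
`E_N(t) = ∑_{|k|≤N} ‖û(t,k)‖²` over a period.  Its derivative is `2∫⟪∂ₜu, P_N u⟫` (the spatial Fourier coefficients
of a jointly smooth field are differentiable in time, `hasDerivAt_mFourierCoeff`), and pairing the momentum equation
with the smooth solenoidal field `P_N u(t)` gives the LOW-MODE ENERGY BALANCE
`½E_N' = -Π_N - νG_N + ∫⟪f_c, u⟫` (`integral_inner_timeDeriv_fourierTruncate`), where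
`Π_N(t) = ∫⟪(u·∇)u, P_N u⟫` is the ENERGY FLUX out of the ball (`flux`), `G_N = 4π²∑_{|k|≤N}|k|²‖û_k‖²` the low-mode
enstrophy, and the band-limited force (`mFourierCoeff_force_eq_zero`, `S ⊆ B_N`) sees all of `u`.  Averaging over the
period (`mean_flux_eq`): `τ⁻¹∫₀^τ Π_N = ⟨ν‖∇u‖²⟩ - ν τ⁻¹∫₀^τ G_N`, with `0 ≤ τ⁻¹∫G_N ≤ 4π²N²⟨‖u‖²⟩`.  HENCE
(`mean_flux_le`, `mean_flux_ge`, `mean_flux_ge_of_loud`, `exists_constantFlux_of_mem_loudSet`): for every witness of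
`c ∈ LOUD_j(S,E,ε)` and EVERY `N` with `S ⊆ B_N`,
`ε - 4π²N²E/(j+1) ≤ τ⁻¹∫₀^τ Π_N ≤ ⟨ν‖∇u‖²⟩` — the mean triadic energy flux is CONSTANT (= the dissipation, up to
`O(N²/j)`) across an inertial range `deg S ≤ N ≪ √j` that widens without bound along the levels: the rigorous skeleton
of Kolmogorov's cascade picture, certified for the crux's witness class.  A construction must therefore organise
scale-by-scale transfer of the full power `ε` through every octave, not merely "some small scales". -/


section Flux

variable {S : Finset (Fin 3 → ℤ)} {ν τ : ℝ} {c : ↥S → (EuclideanSpace ℂ (Fin 3))} {u : ℝ → (UnitAddTorus (Fin 3)) → (EuclideanSpace ℝ (Fin 3))} {p : ℝ → (UnitAddTorus (Fin 3)) → ℝ}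

variable (ν) in
/-- THE LOW-MODE ENERGY BALANCE at a fixed time, for a classical solution forced by `f_c` with `S ⊆ B_N`:
`½ E_N'(t) = ∫⟪∂ₜu, P_N u⟫ = -Π_N(t) - ν G_N(t) + ∫⟪f_c, u(t)⟫` (pressure drops against the solenoidal `P_N u`,
the Laplacian gives the low-mode enstrophy, the band-limited force sees all of `u`). -/
theorem integral_inner_timeDeriv_fourierTruncate (hsol : Torus.IsClassicalNSSolutionOn univ ν (fun _ => force S c) u p)
    {N : ℕ} (hS : S ⊆ Torus.freqBall N) (t : ℝ) :
    ∫ x, ⟪Torus.timeDerivWithin univ u t x, Torus.fourierTruncate N (u t) x⟫_ℝ =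
      -flux N u t - ν * lowEnstrophy N u t + ∫ x, ⟪force S c x, u t x⟫_ℝ := by
  have hu := hsol.smooth_velocity
  have hut : Torus.IsSmooth (u t) := hu.isSmooth_slice (mem_univ t)
  have hdiv : Torus.IsDivFree (u t) := hsol.divFree t (mem_univ t)
  have hφ : Torus.IsSmooth (Torus.fourierTruncate N (u t)) := Torus.isSmooth_fourierTruncate N (u t)
  have hφdiv : Torus.IsDivFree (Torus.fourierTruncate N (u t)) :=
    Torus.isDivFree_fourierTruncate (hut.memLp 2) (Torus.IsDivFree.isWeaklyDivFree_holds hut hdiv) N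
  have hconv : (∫ x, ⟪u t x, Torus.convect (u t) (Torus.fourierTruncate N (u t)) x⟫_ℝ) = -flux N u t := by
    unfold flux
    rw [Torus.integral_inner_convect_eq_neg hut hdiv hut hφ]
    ring
  have hforce : (∫ x, ⟪force S c x, Torus.fourierTruncate N (u t) x⟫_ℝ) = ∫ x, ⟪force S c x, u t x⟫_ℝ := by
    rw [show (∫ x, ⟪force S c x, Torus.fourierTruncate N (u t) x⟫_ℝ) =
        ∫ x, ⟪Torus.fourierTruncate N (u t) x, force S c x⟫_ℝ
        from integral_congr_ae (ae_of_all _ fun x => real_inner_comm _ _),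
      Torus.integral_inner_fourierTruncate_eq (hut.memLp 2) ((isSmooth_force S c).memLp 2)
        (fun k hk => mFourierCoeff_force_eq_zero hS c hk),
      show (∫ x, ⟪u t x, force S c x⟫_ℝ) = ∫ x, ⟪force S c x, u t x⟫_ℝ
        from integral_congr_ae (ae_of_all _ fun x => real_inner_comm _ _)]
  rw [integral_inner_timeDeriv_eq hsol hφ hφdiv t, integral_inner_laplacian_fourierTruncate hut N, hconv, hforce]
  unfold lowEnstrophy
  ring

/-- The low-mode enstrophy is continuous in time. -/
theorem continuous_lowEnstrophy (hu : Torus.IsSmoothSpaceTimeOn univ u) (N : ℕ) : Continuous (lowEnstrophy N u) := by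
  unfold lowEnstrophy
  exact continuous_const.mul (continuous_finsetSum _ fun k _ =>
    continuous_const.mul ((continuous_mFourierCoeff_slice hu k).norm.pow 2))

/-- The derivative of the low-mode energy is continuous in time. -/
theorem continuous_lowEnergyDeriv (hu : Torus.IsSmoothSpaceTimeOn univ u) (N : ℕ) :
    Continuous fun t => ∑ k ∈ Torus.freqBall N,
      2 * (inner ℂ (mFourierCoeff (EuclideanSpace.complexify ∘ Torus.timeDerivWithin univ u t) k)
        (mFourierCoeff (EuclideanSpace.complexify ∘ u t) k)).re := by
  refine continuous_finsetSum _ fun k _ => ?_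
  have h1 := continuous_mFourierCoeff_slice hu k
  have h2 := continuous_mFourierCoeff_slice (hu.timeDerivWithin uniqueDiffOn_univ) k
  exact continuous_const.mul (Complex.continuous_re.comp (h2.inner h1))

/-- THE FLUX IN TERMS OF CONTINUOUS DATA: `Π_N(t) = ∫⟪f_c, u(t)⟫ - ν G_N(t) - ½ E_N'(t)`. -/
theorem flux_eq_of_solution (hsol : Torus.IsClassicalNSSolutionOn univ ν (fun _ => force S c) u p)
    {N : ℕ} (hS : S ⊆ Torus.freqBall N) (t : ℝ) :
    flux N u t = (∫ x, ⟪force S c x, u t x⟫_ℝ) - ν * lowEnstrophy N u t -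
      2⁻¹ * ∑ k ∈ Torus.freqBall N,
        2 * (inner ℂ (mFourierCoeff (EuclideanSpace.complexify ∘ Torus.timeDerivWithin univ u t) k)
          (mFourierCoeff (EuclideanSpace.complexify ∘ u t) k)).re := by
  have h1 := integral_inner_timeDeriv_fourierTruncate ν hsol hS t
  have h2 := lowEnergy_deriv_eq_pairing hsol.smooth_velocity N t
  rw [h2]
  linarith

/-- The flux of a classical solution is continuous in time. -/
theorem continuous_flux (hsol : Torus.IsClassicalNSSolutionOn univ ν (fun _ => force S c) u p)
    {N : ℕ} (hS : S ⊆ Torus.freqBall N) : Continuous (flux N u) := by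
  have hu := hsol.smooth_velocity
  have hP : Continuous fun t => ∫ x, ⟪force S c x, u t x⟫_ℝ :=
    continuousOn_univ.1 (((Torus.isSmoothSpaceTimeOn_const (isSmooth_force S c) univ).inner hu).continuousOn_integral
      convex_univ)
  have hc : Continuous fun t => (∫ x, ⟪force S c x, u t x⟫_ℝ) - ν * lowEnstrophy N u t -
      2⁻¹ * ∑ k ∈ Torus.freqBall N,
        2 * (inner ℂ (mFourierCoeff (EuclideanSpace.complexify ∘ Torus.timeDerivWithin univ u t) k)
          (mFourierCoeff (EuclideanSpace.complexify ∘ u t) k)).re :=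
    (hP.sub (continuous_const.mul (continuous_lowEnstrophy hu N))).sub
      (continuous_const.mul (continuous_lowEnergyDeriv hu N))
  exact hc.congr fun t => (flux_eq_of_solution hsol hS t).symm

/-- THE MEAN-FLUX IDENTITY over a period: for a `τ`-periodic classical orbit forced by `f_c` with `S ⊆ B_N`,
`τ⁻¹∫₀^τ Π_N(t) dt = ⟨ν‖∇u‖²⟩ - ν · τ⁻¹∫₀^τ G_N(t) dt` (the low-mode energy returns to its initial value over
a period; the power input equals the mean dissipation). -/
theorem mean_flux_eq (hsol : Torus.IsClassicalNSSolutionOn univ ν (fun _ => force S c) u p)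
    {N : ℕ} (hS : S ⊆ Torus.freqBall N) (hper : Function.Periodic u τ) (hτ : 0 < τ) :
    τ⁻¹ * ∫ t in (0 : ℝ)..τ, flux N u t =
      meanDissipation ν u - ν * (τ⁻¹ * ∫ t in (0 : ℝ)..τ, lowEnstrophy N u t) := by
  have hu := hsol.smooth_velocity
  set D : ℝ → ℝ := fun t => ∑ k ∈ Torus.freqBall N,
      2 * (inner ℂ (mFourierCoeff (EuclideanSpace.complexify ∘ Torus.timeDerivWithin univ u t) k)
        (mFourierCoeff (EuclideanSpace.complexify ∘ u t) k)).re with hDdef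
  have hDcont : Continuous D := continuous_lowEnergyDeriv hu N
  have hGcont : Continuous (lowEnstrophy N u) := continuous_lowEnstrophy hu N
  have hP : Continuous fun t => ∫ x, ⟪force S c x, u t x⟫_ℝ :=
    continuousOn_univ.1 (((Torus.isSmoothSpaceTimeOn_const (isSmooth_force S c) univ).inner hu).continuousOn_integral
      convex_univ)
  -- `∫₀^τ D = E_N(τ) - E_N(0) = 0`
  have hDint : ∫ t in (0 : ℝ)..τ, D t = 0 := by
    rw [intervalIntegral.integral_eq_sub_of_hasDerivAt (fun t _ => hasDerivAt_lowEnergy hu N t)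
      (hDcont.intervalIntegrable _ _)]
    have h0 : u τ = u 0 := by simpa using hper 0
    simp [lowEnergy, h0]
  -- `∫₀^τ P = τ ⟨ν‖∇u‖²⟩`
  have hPint : ∫ t in (0 : ℝ)..τ, ∫ x, ⟪force S c x, u t x⟫_ℝ = τ * meanDissipation ν u := by
    rw [← period_dissipation_eq_power hsol hper hτ, meanDissipation_eq_period_mean hu hper hτ]
    field_simp
  -- integrate the flux formula
  have hflux : ∫ t in (0 : ℝ)..τ, flux N u t =
      (∫ t in (0 : ℝ)..τ, ∫ x, ⟪force S c x, u t x⟫_ℝ) - ν * (∫ t in (0 : ℝ)..τ, lowEnstrophy N u t) -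
        2⁻¹ * ∫ t in (0 : ℝ)..τ, D t := by
    have hi1 : IntervalIntegrable (fun t => ∫ x, ⟪force S c x, u t x⟫_ℝ) volume 0 τ := hP.intervalIntegrable _ _
    have hi2 : IntervalIntegrable (fun t => ν * lowEnstrophy N u t) volume 0 τ :=
      (continuous_const.mul hGcont).intervalIntegrable _ _
    have hi3 : IntervalIntegrable (fun t => 2⁻¹ * D t) volume 0 τ := (continuous_const.mul hDcont).intervalIntegrable _ _
    have hi12 : IntervalIntegrable (fun t => (∫ x, ⟪force S c x, u t x⟫_ℝ) - ν * lowEnstrophy N u t) volume 0 τ :=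
      hi1.sub hi2
    rw [intervalIntegral.integral_congr (g := fun t => (∫ x, ⟪force S c x, u t x⟫_ℝ) - ν * lowEnstrophy N u t -
        2⁻¹ * D t) (fun t _ => flux_eq_of_solution hsol hS t),
      intervalIntegral.integral_sub hi12 hi3, intervalIntegral.integral_sub hi1 hi2,
      intervalIntegral.integral_const_mul, intervalIntegral.integral_const_mul]
  rw [hflux, hDint, hPint]
  field_simp
  ring

/-- The period mean of the low-mode enstrophy is at most `4π²N²` times the mean energy. -/
theorem mean_lowEnstrophy_le (hu : Torus.IsSmoothSpaceTimeOn univ u) (hper : Function.Periodic u τ) (hτ : 0 < τ)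
    (N : ℕ) :
    τ⁻¹ * ∫ t in (0 : ℝ)..τ, lowEnstrophy N u t ≤ 4 * Real.pi ^ 2 * (N : ℝ) ^ 2 * meanEnergy u := by
  have he_st : Torus.IsSmoothSpaceTimeOn univ (fun t x => ‖u t x‖ ^ 2) := by
    change ContDiffOn ℝ _ (fun z => ‖Torus.stLift u z‖ ^ 2) _
    exact hu.norm_sq ℝ
  have he_cont : Continuous fun t => ∫ x, ‖u t x‖ ^ 2 :=
    continuousOn_univ.1 (he_st.continuousOn_integral convex_univ)
  have hpt : ∀ t, lowEnstrophy N u t ≤ 4 * Real.pi ^ 2 * (N : ℝ) ^ 2 * ∫ x, ‖u t x‖ ^ 2 := fun t =>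
    (lowEnstrophy_le N u t).trans (mul_le_mul_of_nonneg_left (lowEnergy_le hu N t) (by positivity))
  have hmono : ∫ t in (0 : ℝ)..τ, lowEnstrophy N u t ≤ ∫ t in (0 : ℝ)..τ, 4 * Real.pi ^ 2 * (N : ℝ) ^ 2 * ∫ x, ‖u t x‖ ^ 2 :=
    intervalIntegral.integral_mono_on hτ.le ((continuous_lowEnstrophy hu N).intervalIntegrable _ _)
      ((he_cont.const_mul _).intervalIntegrable _ _) fun t _ => hpt t
  rw [intervalIntegral.integral_const_mul] at hmono
  rw [meanEnergy_eq_period_mean hper hτ]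
  have hτinv : 0 ≤ τ⁻¹ := inv_nonneg.2 hτ.le
  calc τ⁻¹ * ∫ t in (0 : ℝ)..τ, lowEnstrophy N u t
      ≤ τ⁻¹ * (4 * Real.pi ^ 2 * (N : ℝ) ^ 2 * ∫ t in (0 : ℝ)..τ, ∫ x, ‖u t x‖ ^ 2) :=
        mul_le_mul_of_nonneg_left hmono hτinv
    _ = 4 * Real.pi ^ 2 * (N : ℝ) ^ 2 * (τ⁻¹ * ∫ t in (0 : ℝ)..τ, ∫ x, ‖u t x‖ ^ 2) := by ring

/-- The period mean of the low-mode enstrophy is nonnegative. -/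
theorem mean_lowEnstrophy_nonneg (u : ℝ → (UnitAddTorus (Fin 3)) → (EuclideanSpace ℝ (Fin 3))) (hτ : 0 < τ) (N : ℕ) :
    0 ≤ τ⁻¹ * ∫ t in (0 : ℝ)..τ, lowEnstrophy N u t :=
  mul_nonneg (inv_nonneg.2 hτ.le)
    (intervalIntegral.integral_nonneg hτ.le fun t _ => lowEnstrophy_nonneg N u t)

/-- CONSTANT-FLUX LAW, upper half: the mean flux through any wavenumber `N` (`S ⊆ B_N`) never exceeds the mean
dissipation (`ν ≥ 0`). -/
theorem mean_flux_le (hsol : Torus.IsClassicalNSSolutionOn univ ν (fun _ => force S c) u p)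
    {N : ℕ} (hS : S ⊆ Torus.freqBall N) (hν : 0 ≤ ν) (hper : Function.Periodic u τ) (hτ : 0 < τ) :
    τ⁻¹ * ∫ t in (0 : ℝ)..τ, flux N u t ≤ meanDissipation ν u := by
  rw [mean_flux_eq hsol hS hper hτ]
  have := mean_lowEnstrophy_nonneg u hτ N
  nlinarith

/-- CONSTANT-FLUX LAW, lower half: the mean flux through any wavenumber `N` with `S ⊆ B_N` is at least the mean
dissipation minus `4π²N²ν⟨‖u‖²⟩` — for a loud bounded orbit the whole dissipation `ε` is transported by the
triadic interactions through EVERY shell boundary beyond the forcing band, up to `O(N²ν)`. -/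
theorem mean_flux_ge (hsol : Torus.IsClassicalNSSolutionOn univ ν (fun _ => force S c) u p)
    {N : ℕ} (hS : S ⊆ Torus.freqBall N) (hν : 0 ≤ ν) (hper : Function.Periodic u τ) (hτ : 0 < τ) :
    meanDissipation ν u - 4 * Real.pi ^ 2 * (N : ℝ) ^ 2 * ν * meanEnergy u ≤ τ⁻¹ * ∫ t in (0 : ℝ)..τ, flux N u t := by
  rw [mean_flux_eq hsol hS hper hτ]
  have := mean_lowEnstrophy_le hsol.smooth_velocity hper hτ N
  nlinarith

variable {E ε : ℝ}

/-- CONSTANT-FLUX LAW ON THE LOUD SET: a witness of `c ∈ LOUD_j(S,E,ε)` transports mean energy flux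
`≥ ε - 4π²N²E/(j+1)` through every wavenumber `N` with `S ⊆ B_N`. -/
theorem mean_flux_ge_of_loud (hsol : Torus.IsClassicalNSSolutionOn univ ν (fun _ => force S c) u p)
    {N : ℕ} (hS : S ⊆ Torus.freqBall N) (hν : 0 < ν) {j : ℕ} (hνj : ν < 1 / ((j : ℝ) + 1))
    (hper : Function.Periodic u τ) (hτ : 0 < τ) (hEu : meanEnergy u ≤ E) (hεu : ε ≤ meanDissipation ν u) :
    ε - 4 * Real.pi ^ 2 * (N : ℝ) ^ 2 * E / ((j : ℝ) + 1) ≤ τ⁻¹ * ∫ t in (0 : ℝ)..τ, flux N u t := by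
  have h := mean_flux_ge hsol hS hν.le hper hτ
  have hmE := meanEnergy_nonneg' hper hτ
  have hE : 0 ≤ E := hmE.trans hEu
  have hj : (0 : ℝ) < (j : ℝ) + 1 := by positivity
  have h1 : 4 * Real.pi ^ 2 * (N : ℝ) ^ 2 * ν * meanEnergy u ≤ 4 * Real.pi ^ 2 * (N : ℝ) ^ 2 * E / ((j : ℝ) + 1) := by
    rw [le_div_iff₀ hj]
    have hνj' : ν * ((j : ℝ) + 1) ≤ 1 := by
      have := hνj.le; rwa [le_div_iff₀ hj] at this
    have h0 : 0 ≤ 4 * Real.pi ^ 2 * (N : ℝ) ^ 2 := by positivity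
    calc 4 * Real.pi ^ 2 * (N : ℝ) ^ 2 * ν * meanEnergy u * ((j : ℝ) + 1)
        = 4 * Real.pi ^ 2 * (N : ℝ) ^ 2 * (ν * ((j : ℝ) + 1)) * meanEnergy u := by ring
      _ ≤ 4 * Real.pi ^ 2 * (N : ℝ) ^ 2 * 1 * E := by gcongr
      _ = 4 * Real.pi ^ 2 * (N : ℝ) ^ 2 * E := by ring
  linarith

/-- THE CASCADE OF A LOUD ORBIT IS COMPLETE: every `c ∈ LOUD_j(S,E,ε)` has a witness whose mean energy flux
through wavenumber `N` lies in `[ε - 4π²N²E/(j+1), ⟨ν‖∇u‖²⟩]` for EVERY `N` with `S ⊆ B_N` — uniformly constant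
(`= ε + O(N²/j)`) across an "inertial range" that widens without bound along the levels. -/
theorem exists_constantFlux_of_mem_loudSet {j : ℕ} (hc : c ∈ loudSet S E ε j) :
    ∃ (ν τ : ℝ) (u : ℝ → (UnitAddTorus (Fin 3)) → (EuclideanSpace ℝ (Fin 3))) (p : ℝ → (UnitAddTorus (Fin 3)) → ℝ), 0 < ν ∧ ν < 1 / ((j : ℝ) + 1) ∧ 0 < τ ∧
      Torus.IsClassicalNSSolutionOn univ ν (fun _ => force S c) u p ∧ Function.Periodic u τ ∧
      ε ≤ meanDissipation ν u ∧
      ∀ N : ℕ, S ⊆ Torus.freqBall N →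
        ε - 4 * Real.pi ^ 2 * (N : ℝ) ^ 2 * E / ((j : ℝ) + 1) ≤ τ⁻¹ * ∫ t in (0 : ℝ)..τ, flux N u t ∧
        τ⁻¹ * ∫ t in (0 : ℝ)..τ, flux N u t ≤ meanDissipation ν u := by
  obtain ⟨ν, hν, hνj, τ, u, p, hτ, hsol, hper, hEu, hεu⟩ := hc
  exact ⟨ν, τ, u, p, hν, hνj, hτ, hsol, hper, hεu, fun N hS =>
    ⟨mean_flux_ge_of_loud hsol hS hν hνj hper hτ hEu hεu, mean_flux_le hsol hS hν.le hper hτ⟩⟩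

/-- Every stock lies in some frequency ball (so the constant-flux law is never vacuous). -/
theorem exists_subset_freqBall (S : Finset (Fin 3 → ℤ)) : ∃ N : ℕ, S ⊆ Torus.freqBall N := by
  classical
  induction S using Finset.induction_on with
  | empty => exact ⟨0, Finset.empty_subset _⟩
  | insert k S hk ih =>
    obtain ⟨N, hN⟩ := ih
    obtain ⟨M, hM⟩ := Torus.exists_mem_freqBall k
    refine ⟨max N M, Finset.insert_subset_iff.2 ⟨Torus.freqBall_mono (le_max_right _ _) hM,
      hN.trans (Torus.freqBall_mono (le_max_left _ _))⟩⟩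

end Flux

end Summit.AnomalousDissipation.AnomalousDissipation.Theorems.DenseLoudDesignerForces.Negative

end
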